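import Mathlib
import Literature.Geometry.DiscreteGeometry.TwoShellPatterns
import Literature.MathematicalPhysics.StatisticalMechanics.BarlowStacking

/-!
# Stub `stub_offFamilyOfNonLayered` (C′) of the line `birth` of the crux `NashClassCertificates.NashNearField`

Pure geometry.  At a particle `i`, suppose the 3-ball of `x i` is two-way `ν`-matched with
`x i + G(T_s)`, where `T_s = barlowPos 1 (√6/3) s` is the unit ideal Barlow template of a Hägg word
`s` and `G` is a continuous linear map with the global bi-Lipschitz bounds `4/5`, `6/5`.  If the
2-ball of `x i` is NOT `η`-layered (the crux's inline predicate) and `0 ≤ ν ≤ η/2`, `η ≤ 1/10`,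
then for every linear isometry `A` and every box cell `(a, h)` (`47/50 ≤ a ≤ 1`,
`39a/50 ≤ h ≤ 17a/20`) some template site of norm `≤ 3` has
`dist (G p₁) (A p_{a,h}) ≥ η − ν`.

The proof is the contrapositive: if every site of norm `≤ 3` is `(η − ν)`-close, then after the
translation `t = −x i` the configuration is `η`-matched with the layered set
`A (barlowPos a h s) = {A (u • u(a) + v • v(a) + L_m • w(a) + (m h) • e₃)}` (uniform spacings
`z m = m h`), using the norm comparison `‖p₁‖² ≤ 2 ‖p_{a,h}‖²` between the unit and the box-scaled
templates and the bi-Lipschitz bounds to stay inside the flatness radius `3`.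
-/

noncomputable section

open Literature.MathematicalPhysics.StatisticalMechanics Literature.Geometry.DiscreteGeometry

namespace Summit.AtomisticToContinuum.Crystallization.Theorems.NashClassCertificatesNashNearField

/-- Squared norm of a template point in coordinates:
`‖i u + j v + L w + k h e₃‖² = a² (X² + ¾ Y²) + k² h²` with `X = i + j/2 + L/2`, `Y = j + L/3`.
[folklore] -/
theorem offFamily_norm_barlowPos_sq (a h : ℝ) (s : ℤ → ℤ) (k i j : ℤ) :
    ‖barlowPos a h s k i j‖ ^ 2 =
      a ^ 2 * (((i : ℝ) + j / 2 + haggLabel s k / 2) ^ 2 + 3 / 4 * ((j : ℝ) + haggLabel s k / 3) ^ 2) +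
        (k : ℝ) ^ 2 * h ^ 2 := by
  rw [EuclideanSpace.real_norm_sq_eq, Fin.sum_univ_three, barlowPos_apply_zero, barlowPos_apply_one,
    barlowPos_apply_two]
  have h3 : (√3 : ℝ) ^ 2 = 3 := Real.sq_sqrt (by norm_num)
  linear_combination (a ^ 2 * ((j : ℝ) + haggLabel s k / 3) ^ 2 / 4) * h3

/-- Squared norm of a site of the unit ideal template (`a = 1`, `h = √6/3`, `h² = 2/3`).
[folklore] -/
theorem offFamily_norm_unit_sq (s : ℤ → ℤ) (k i j : ℤ) :
    ‖barlowPos 1 (Real.sqrt 6 / 3) s k i j‖ ^ 2 =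
      (((i : ℝ) + j / 2 + haggLabel s k / 2) ^ 2 + 3 / 4 * ((j : ℝ) + haggLabel s k / 3) ^ 2) +
        2 / 3 * (k : ℝ) ^ 2 := by
  rw [offFamily_norm_barlowPos_sq]
  have h6 : (Real.sqrt 6) ^ 2 = 6 := Real.sq_sqrt (by norm_num)
  linear_combination ((k : ℝ) ^ 2 / 9) * h6

/-- **Norm comparison of the two templates.**  For a box cell `(a, h)` (`a ≥ 47/50`,
`h ≥ 39a/50`) the unit ideal site is at most `√2` times as long as the box-scaled site:
`‖p₁‖² ≤ 2 ‖p_{a,h}‖²` (in-plane factor `2a² ≥ 1`, normal factor `2h² ≥ 2/3`). [folklore] -/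
theorem offFamily_norm_sq_unit_le {a h : ℝ} (ha : 47 / 50 ≤ a) (hh : 39 / 50 * a ≤ h)
    (s : ℤ → ℤ) (k i j : ℤ) :
    ‖barlowPos 1 (Real.sqrt 6 / 3) s k i j‖ ^ 2 ≤ 2 * ‖barlowPos a h s k i j‖ ^ 2 := by
  rw [offFamily_norm_unit_sq, offFamily_norm_barlowPos_sq]
  have hQ : 0 ≤ ((i : ℝ) + j / 2 + haggLabel s k / 2) ^ 2 + 3 / 4 * ((j : ℝ) + haggLabel s k / 3) ^ 2 := by
    positivity
  have ha2 : 1 ≤ 2 * a ^ 2 := by nlinarith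
  have hc : (1833 : ℝ) / 2500 ≤ h := by linarith
  have hh1 : 1 / 3 ≤ h ^ 2 := by nlinarith
  nlinarith [mul_le_mul_of_nonneg_right ha2 hQ, mul_le_mul_of_nonneg_right hh1 (sq_nonneg (k : ℝ))]

/-- `c • (h e₃) = (c h) • e₃`. [folklore] -/
theorem offFamily_smul_layerNormal (h c : ℝ) : c • layerNormal h = (c * h) • layerNormal 1 := by
  ext l
  fin_cases l <;> simp [layerNormal]

/-- The layered-set parametrisation with uniform spacings `z m = m h` is the box-scaled template:
`u • u(a) + v • v(a) + L_m • w(a) + (m h) • e₃ = barlowPos a h s m u v`. [folklore] -/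
theorem offFamily_barlowPos_eq (a h : ℝ) (s : ℤ → ℤ) (m u v : ℤ) :
    (u : ℝ) • triangularVec₁ a + (v : ℝ) • triangularVec₂ a + (haggLabel s m : ℝ) • barlowOffset a +
        ((m : ℝ) * h) • layerNormal 1 = barlowPos a h s m u v := by
  rw [barlowPos, offFamily_smul_layerNormal h (m : ℝ)]

/-- **Stub `stub_offFamilyOfNonLayered` (C′, GEOMETRY).**  At a particle `i`, let `G` be a continuous
linear map and `ν ≥ 0` such that the 3-ball of `x i` is two-way `ν`-matched with `x i + G(T_s)`, `T_s` the unit ideal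
Barlow template `barlowPos 1 (√6/3) s` of a Hägg word `s` (`G` globally bi-Lipschitz with constants `4/5`, `6/5`).
If the 2-ball of `x i` is NOT `η`-layered (the crux's predicate) and `ν ≤ η/2 ≤ 1/20`, then `G` is `(η − ν)`-far
from the family on the template: for every linear isometry `A` and every box cell `(a, h)` some site `p` of norm `≤ 3`
has `dist (G p₁) (A p_{a,h}) ≥ η − ν` (`p₁` the unit site, `p_{a,h} = barlowPos a h s` the same site of the box-scaled
template).  Proof: contrapositive — if all sites of norm `≤ 3` are within `η − ν` then `x` is `η`-matched, after the
translation `t = −x i`, with the layered set `A (barlowPos a h s) = {A (u • u(a) + v • v(a) + L_m • w(a) + z_m • e₃)}`,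
`z_m = m h`; particles within `2` of `x i` have their unit site of norm `≤ (5/4)(2 + ν) ≤ 3`, template points within
`2` come from unit sites of norm `≤ 2√2 ≤ 3`, and `‖G p₁‖ < 2 + (η − ν) ≤ 3` keeps them inside the flatness radius.
[folklore geometry] -/
theorem stub_offFamilyOfNonLayered :
    ∀ (N : ℕ) (x : Fin N → EuclideanSpace ℝ (Fin 3)) (i : Fin N) (s : ℤ → ℤ) (G : EuclideanSpace ℝ (Fin 3) →L[ℝ] EuclideanSpace ℝ (Fin 3)) (ν η : ℝ),
      IsHaggSeq s → 0 ≤ ν → ν ≤ η / 2 → η ≤ 1 / 10 →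
      ((∀ j : Fin N, dist (x j) (x i) ≤ 3 → ∃ m u v : ℤ, dist (x j - x i) (G (barlowPos 1 (Real.sqrt 6 / 3) s m u v)) ≤ ν) ∧ (∀ m u v : ℤ, ‖G (barlowPos 1 (Real.sqrt 6 / 3) s m u v)‖ ≤ 3 → ∃ j : Fin N, dist (x j - x i) (G (barlowPos 1 (Real.sqrt 6 / 3) s m u v)) ≤ ν) ∧ (∀ p : EuclideanSpace ℝ (Fin 3), 4 / 5 * ‖p‖ ≤ ‖G p‖ ∧ ‖G p‖ ≤ 6 / 5 * ‖p‖)) →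
      ¬ (∃ (A : EuclideanSpace ℝ (Fin 3) →ₗᵢ[ℝ] EuclideanSpace ℝ (Fin 3)) (t : EuclideanSpace ℝ (Fin 3)) (a : ℝ) (s : ℤ → ℤ) (z : ℤ → ℝ), 47 / 50 ≤ a ∧ a ≤ 1 ∧ IsHaggSeq s ∧ (∀ m : ℤ, 39 / 50 * a ≤ z (m + 1) - z m ∧ z (m + 1) - z m ≤ 17 / 20 * a) ∧ (fun S : Set (EuclideanSpace ℝ (Fin 3)) => (∀ j : Fin N, dist (x j) (x i) ≤ 2 → ∃ p ∈ S, dist (x j + t) p ≤ η) ∧ (∀ p ∈ S, dist p (x i + t) ≤ 2 → ∃ j : Fin N, dist (x j + t) p ≤ η)) {p | ∃ m i j : ℤ, p = A (((i : ℝ) • triangularVec₁ a) + ((j : ℝ) • triangularVec₂ a) + ((haggLabel s m : ℝ) • barlowOffset a) + (z m • layerNormal 1))}) →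
      (∀ (A : EuclideanSpace ℝ (Fin 3) →ₗᵢ[ℝ] EuclideanSpace ℝ (Fin 3)) (a h : ℝ), 47 / 50 ≤ a → a ≤ 1 → 39 / 50 * a ≤ h → h ≤ 17 / 20 * a → ∃ m u v : ℤ, ‖barlowPos 1 (Real.sqrt 6 / 3) s m u v‖ ≤ 3 ∧ (η - ν) ≤ dist (G (barlowPos 1 (Real.sqrt 6 / 3) s m u v)) (A (barlowPos a h s m u v))) := by
  intro N x i s G ν η hs hν hνη hη hflat hNL A a h ha₁ ha₂ hh₁ hh₂
  obtain ⟨hF1, hF2, hF3⟩ := hflat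
  by_contra hcon
  push Not at hcon
  -- `hcon`: every unit site of norm `≤ 3` is `(η − ν)`-close to the isometric box-scaled copy.
  apply hNL
  refine ⟨A, -x i, a, s, fun m => (m : ℝ) * h, ha₁, ha₂, hs, ?_, ?_⟩
  · -- uniform spacings `z (m + 1) - z m = h` are in the box
    intro m
    show 39 / 50 * a ≤ ((m + 1 : ℤ) : ℝ) * h - (m : ℝ) * h ∧ ((m + 1 : ℤ) : ℝ) * h - (m : ℝ) * h ≤ 17 / 20 * a
    have e : ((m + 1 : ℤ) : ℝ) * h - (m : ℝ) * h = h := by push_cast; ring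
    rw [e]
    exact ⟨hh₁, hh₂⟩
  · refine ⟨fun j hj => ?_, fun p hp hd => ?_⟩
    · -- particles within `2` of `x i` are `η`-close to the layered set
      obtain ⟨m, u, v, hm⟩ := hF1 j (by linarith)
      have hG : ‖G (barlowPos 1 (Real.sqrt 6 / 3) s m u v)‖ ≤ 2 + ν := by
        have h1 : ‖G (barlowPos 1 (Real.sqrt 6 / 3) s m u v)‖ ≤
            ‖x j - x i‖ + ‖G (barlowPos 1 (Real.sqrt 6 / 3) s m u v) - (x j - x i)‖ :=
          norm_le_insert' _ _
        have h2 : ‖G (barlowPos 1 (Real.sqrt 6 / 3) s m u v) - (x j - x i)‖ =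
            dist (x j - x i) (G (barlowPos 1 (Real.sqrt 6 / 3) s m u v)) := by
          rw [dist_eq_norm, norm_sub_rev]
        have h3 : ‖x j - x i‖ = dist (x j) (x i) := (dist_eq_norm _ _).symm
        linarith
      have hp3 : ‖barlowPos 1 (Real.sqrt 6 / 3) s m u v‖ ≤ 3 := by
        have := (hF3 (barlowPos 1 (Real.sqrt 6 / 3) s m u v)).1
        linarith
      have hclose := hcon m u v hp3
      refine ⟨A (barlowPos a h s m u v), ⟨m, u, v, ?_⟩, ?_⟩
      · exact congrArg A (offFamily_barlowPos_eq a h s m u v).symm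
      · rw [← sub_eq_add_neg]
        calc dist (x j - x i) (A (barlowPos a h s m u v))
            ≤ dist (x j - x i) (G (barlowPos 1 (Real.sqrt 6 / 3) s m u v)) +
                dist (G (barlowPos 1 (Real.sqrt 6 / 3) s m u v)) (A (barlowPos a h s m u v)) :=
              dist_triangle _ _ _
          _ ≤ η := by linarith
    · -- template points within `2` of `x i + t = 0` are `η`-close to particles
      obtain ⟨m, u, v, hp⟩ := hp
      have hpq : p = A (barlowPos a h s m u v) :=
        hp.trans (congrArg A (offFamily_barlowPos_eq a h s m u v))
      subst hpq
      have hq2 : ‖barlowPos a h s m u v‖ ≤ 2 := by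
        rw [add_neg_cancel, dist_zero_right, LinearIsometry.norm_map] at hd
        exact hd
      have hp3 : ‖barlowPos 1 (Real.sqrt 6 / 3) s m u v‖ ≤ 3 := by
        have hsq := offFamily_norm_sq_unit_le ha₁ hh₁ s m u v
        have hq4 : ‖barlowPos a h s m u v‖ ^ 2 ≤ 4 := by
          nlinarith [norm_nonneg (barlowPos a h s m u v)]
        nlinarith [norm_nonneg (barlowPos 1 (Real.sqrt 6 / 3) s m u v)]
      have hclose := hcon m u v hp3
      have hG3 : ‖G (barlowPos 1 (Real.sqrt 6 / 3) s m u v)‖ ≤ 3 := by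
        have h1 : ‖G (barlowPos 1 (Real.sqrt 6 / 3) s m u v)‖ ≤
            ‖A (barlowPos a h s m u v)‖ +
              ‖G (barlowPos 1 (Real.sqrt 6 / 3) s m u v) - A (barlowPos a h s m u v)‖ :=
          norm_le_insert' _ _
        rw [LinearIsometry.norm_map, ← dist_eq_norm] at h1
        linarith
      obtain ⟨j, hj⟩ := hF2 m u v hG3
      refine ⟨j, ?_⟩
      rw [← sub_eq_add_neg]
      calc dist (x j - x i) (A (barlowPos a h s m u v))
          ≤ dist (x j - x i) (G (barlowPos 1 (Real.sqrt 6 / 3) s m u v)) +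
              dist (G (barlowPos 1 (Real.sqrt 6 / 3) s m u v)) (A (barlowPos a h s m u v)) :=
            dist_triangle _ _ _
        _ ≤ η := by linarith

end Summit.AtomisticToContinuum.Crystallization.Theorems.NashClassCertificatesNashNearField

end
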